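import Literature.Barriers.Parity.SiegelZeroPrimePairs
import Literature.NumberTheory.Sieve.HardyLittlewoodProofs
import Mathlib.NumberTheory.Chebyshev
import Mathlib.Analysis.SpecialFunctions.Pow.Asymptotics
import HarnessLib

/-!
# Hardy–Littlewood's Conjecture A in von Mangoldt form: the count asymptotic implies the
# `Λ`-weighted asymptotic and the Weak Hardy–Littlewood–Goldbach Conjecture

Topic `Literature/NumberTheory/Sieve`. Everything in this file is PROVED (theorems only, no new
definitions, no named facts).

The tree registers Hardy–Littlewood's Conjecture A in its COUNT form
(`Literature.NumberTheory.Sieve.HardyLittlewoodGoldbach`: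
`R(N) = #{(p, q) : p + q = N} ∼ 𝔖(N) N/(log N)²` along even `N`), while the Siegel-zero
literature (Goldston–Suriajaya 2021, Matomäki–Merikoski 2023, Friedlander–Goldston–Iwaniec–
Suriajaya 2022) consumes the von Mangoldt form `ψ₂(n) = G(n) = ∑_{m + m' = n} Λ(m)Λ(m')`
(`Literature.NumberTheory.Sieve.goldbachLambdaCount`), e.g. as the **Weak Hardy–Littlewood
Goldbach Conjecture** `δ𝔖(n)n ≤ ψ₂(n) ≤ (2 − δ)𝔖(n)n` of Goldston–Suriajaya (5)
(`Literature.Barriers.Parity.WeakHLGoldbachConj δ`). This file proves the classical passage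
between the two (partial summation in its crudest form: prime powers are negligible by
Chebyshev's `ψ(x) − θ(x) ≤ 2√x log x`, and almost all representations have both primes
`> N^{1−η}`):

* `goldbachLambdaCount_le` — for every `n ≥ 1`,
  `G(n) ≤ R(n) (log n)² + 4 √n (log n)²` (unconditional);
* `goldbachLambdaCount_ge` — for every `n` and every real `y ≥ 1`,
  `G(n) ≥ (R(n) − 2(⌊y⌋ + 1)) (log y)²` (unconditional);
* `HardyLittlewoodGoldbach.eventually_goldbachLambdaCount_bounds` — under Conjecture A, for every
  `ε > 0`, `(1 − ε)𝔖(n)n ≤ G(n) ≤ (1 + ε)𝔖(n)n` for all large even `n`;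
* `HardyLittlewoodGoldbach.isEquivalent_goldbachLambdaCount` — hence `G(n) ∼ 𝔖(n)n`
  (`= goldbachHLMain n`, Granville's `J(N)`) along even `n`;
* `HardyLittlewoodGoldbach.weakHLGoldbachConj` — and the Weak Hardy–Littlewood Goldbach
  Conjecture holds for EVERY `0 < δ < 1`.

Consequence for the Parity ladder (parity-ideate-p4 ROUND-1 §4, task T1): composed with the
summit-side theorem `GeneralizedHardyLittlewood → HardyLittlewoodGoldbach`, the Goldston–Suriajaya
`log²`-repulsion of real zeros (`Literature.Barriers.Parity.GoldstonSuriajaya2021_goldbach`, and the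
Matomäki–Merikoski reading `MatomakiMerikoski2023.lFunction_ne_zero_of_weakHLGoldbachConj`) becomes
a consequence of the summit with no Λ-form hypothesis left over.

## References

* G. H. Hardy, J. E. Littlewood, *Some problems of 'Partitio numerorum'; III*, Acta Math. 44
  (1923), §4.1, Conjecture A, (4.11)–(4.12), p. 32 (the count form `N₂(n)`; "attention being paid
  to order"). [HardyLittlewoodPN3]
* D. A. Goldston, A. I. Suriajaya, *Note on the Goldbach conjecture and Landau–Siegel zeros*,
  arXiv:2104.09407 (2021), §1: (1) `ψ₂(n) = ∑_{m+m'=n} Λ(m)Λ(m')`, (2) "The Hardy–Littlewood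
  Goldbach conjecture: for `n` even, `ψ₂(n) ∼ 𝔖(n)n`", (5) the Weak Hardy–Littlewood Goldbach
  Conjecture. [GoldstonSuriajaya2021]
* A. Granville, *Refinements of Goldbach's conjecture, and the generalized Riemann hypothesis*,
  Funct. Approx. 37 (2007) 159–173, §1 (the passage between `#{p + q = N}` and
  `G(N) = ∑ Λ(a)Λ(b)`; prime powers contribute `O(√N log² N)`). [folklore]
-/

noncomputable section

open Filter Finset Asymptotics Real
open scoped ArithmeticFunction.vonMangoldt Chebyshev Topology

namespace Literature.NumberTheory.Sieve

open Literature.Barriers.Parity (WeakHLGoldbachConj)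

/-! ### The prime pairs of the antidiagonal -/

/-- The ordered prime pairs `(p, q)` with `p + q = n` are the filter
`(antidiagonal n).filter (·.1.Prime ∧ ·.2.Prime)`; their number is `R(n)` by definition of
`SingularSeries.goldbachCount` (no auxiliary definition is introduced). [folklore] -/
private theorem card_primePairs (n : ℕ) :
    #((antidiagonal n).filter fun pq => pq.1.Prime ∧ pq.2.Prime) = SingularSeries.goldbachCount n :=
  rfl

/-- Membership in the prime-pair filter. [folklore] -/
private theorem mem_primePairs {n : ℕ} {pq : ℕ × ℕ} :
    pq ∈ ((antidiagonal n).filter fun pq => pq.1.Prime ∧ pq.2.Prime) ↔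
      pq.1 + pq.2 = n ∧ pq.1.Prime ∧ pq.2.Prime := by
  simp [Finset.HasAntidiagonal.mem_antidiagonal]

/-- `Λ(m) ≤ log n` for `m ≤ n`. [folklore] -/
private theorem vonMangoldt_le_log_of_le {m n : ℕ} (h : m ≤ n) : Λ m ≤ Real.log n := by
  refine ArithmeticFunction.vonMangoldt_le_log.trans ?_
  rcases Nat.eq_zero_or_pos m with rfl | hm
  · simp only [Nat.cast_zero, Real.log_zero]; exact Real.log_natCast_nonneg n
  · exact Real.log_le_log (by exact_mod_cast hm) (by exact_mod_cast h)

/-- `∑_{a ≤ n, a not prime} Λ(a) = ψ(n) − θ(n)` (the `a = 0` term vanishes). [folklore] -/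
private theorem sum_range_not_prime_vonMangoldt (n : ℕ) :
    ∑ a ∈ (range (n + 1)).filter (fun a => ¬ a.Prime), Λ a = ψ (n : ℝ) - θ (n : ℝ) := by
  rw [Chebyshev.psi_sub_theta_eq_sum_not_prime, Nat.floor_natCast]
  symm
  refine Finset.sum_subset (fun a ha => ?_) (fun a ha ha' => ?_)
  · simp only [mem_filter, mem_Ioc, mem_range] at ha ⊢
    exact ⟨by omega, ha.2⟩
  · simp only [mem_filter, mem_Ioc, mem_range, not_and] at ha ha'
    have : a = 0 := by
      by_contra h0
      exact ha' (by omega) ha.2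
    simp [this]

/-- The pairs with a NON-prime first entry contribute at most `log n · (ψ(n) − θ(n))`. [folklore] -/
private theorem sum_fst_not_prime_le (n : ℕ) :
    ∑ pq ∈ (antidiagonal n).filter (fun pq => ¬ pq.1.Prime), Λ pq.1 * Λ pq.2 ≤
      Real.log n * (ψ (n : ℝ) - θ (n : ℝ)) := by
  calc ∑ pq ∈ (antidiagonal n).filter (fun pq => ¬ pq.1.Prime), Λ pq.1 * Λ pq.2
      ≤ ∑ pq ∈ (antidiagonal n).filter (fun pq => ¬ pq.1.Prime), Λ pq.1 * Real.log n := by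
        refine Finset.sum_le_sum fun pq hpq => ?_
        have hle : pq.2 ≤ n := Finset.HasAntidiagonal.antidiagonal.snd_le (mem_filter.1 hpq).1
        exact mul_le_mul_of_nonneg_left (vonMangoldt_le_log_of_le hle)
          ArithmeticFunction.vonMangoldt_nonneg
    _ = Real.log n * ∑ pq ∈ (antidiagonal n).filter (fun pq => ¬ pq.1.Prime), Λ pq.1 := by
        rw [Finset.mul_sum]; exact Finset.sum_congr rfl fun _ _ => mul_comm _ _
    _ = Real.log n * ∑ a ∈ (range (n + 1)).filter (fun a => ¬ a.Prime), Λ a := by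
        congr 1
        rw [Finset.sum_filter, Finset.sum_filter,
          Finset.Nat.sum_antidiagonal_eq_sum_range_succ (fun a _ => if ¬ a.Prime then Λ a else 0)]
    _ = Real.log n * (ψ (n : ℝ) - θ (n : ℝ)) := by rw [sum_range_not_prime_vonMangoldt]

/-- The pairs with a NON-prime second entry contribute at most `log n · (ψ(n) − θ(n))` (by the
symmetry `(a, b) ↦ (b, a)` of the antidiagonal). [folklore] -/
private theorem sum_snd_not_prime_le (n : ℕ) :
    ∑ pq ∈ (antidiagonal n).filter (fun pq => ¬ pq.2.Prime), Λ pq.1 * Λ pq.2 ≤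
      Real.log n * (ψ (n : ℝ) - θ (n : ℝ)) := by
  have hswap : ∑ pq ∈ (antidiagonal n).filter (fun pq => ¬ pq.2.Prime), Λ pq.1 * Λ pq.2 =
      ∑ pq ∈ (antidiagonal n).filter (fun pq => ¬ pq.1.Prime), Λ pq.1 * Λ pq.2 := by
    rw [Finset.sum_filter, Finset.sum_filter, ← Finset.Nat.sum_antidiagonal_swap]
    refine Finset.sum_congr rfl fun pq _ => ?_
    simp only [Prod.fst_swap, Prod.snd_swap]
    split_ifs <;> ring
  rw [hswap]
  exact sum_fst_not_prime_le n

/-! ### Unconditional comparison of `G(n)` with `R(n)` -/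

/-- **Upper comparison** (unconditional): for `n ≥ 1`,
`G(n) = ∑_{a+b=n} Λ(a)Λ(b) ≤ R(n)(log n)² + 4√n (log n)²` — the prime pairs contribute at most
`(log n)²` each, the pairs containing a higher prime power at most `2 log n (ψ(n) − θ(n))`, and
`ψ(n) − θ(n) ≤ 2√n log n` (Chebyshev; Mathlib). [cite: GoldstonSuriajaya2021, §1 (1)–(2)] -/
theorem goldbachLambdaCount_le {n : ℕ} (hn : 1 ≤ n) :
    goldbachLambdaCount n ≤
      (SingularSeries.goldbachCount n : ℝ) * Real.log n ^ 2 + 4 * Real.sqrt n * Real.log n ^ 2 := by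
  have hlog : 0 ≤ Real.log n := Real.log_natCast_nonneg n
  have hP : ∑ pq ∈ ((antidiagonal n).filter fun pq => pq.1.Prime ∧ pq.2.Prime), Λ pq.1 * Λ pq.2 ≤
      (SingularSeries.goldbachCount n : ℝ) * Real.log n ^ 2 := by
    rw [← card_primePairs]
    calc ∑ pq ∈ ((antidiagonal n).filter fun pq => pq.1.Prime ∧ pq.2.Prime), Λ pq.1 * Λ pq.2 ≤ ∑ pq ∈ ((antidiagonal n).filter fun pq => pq.1.Prime ∧ pq.2.Prime), Real.log n ^ 2 := by
          refine Finset.sum_le_sum fun pq hpq => ?_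
          have hmem := (mem_primePairs.1 hpq).1
          rw [sq]
          exact mul_le_mul (vonMangoldt_le_log_of_le (by omega)) (vonMangoldt_le_log_of_le (by omega))
            ArithmeticFunction.vonMangoldt_nonneg hlog
      _ = (#((antidiagonal n).filter fun pq => pq.1.Prime ∧ pq.2.Prime) : ℝ) * Real.log n ^ 2 := by rw [Finset.sum_const, nsmul_eq_mul]
  have hNP : ∑ pq ∈ (antidiagonal n).filter (fun pq => ¬ (pq.1.Prime ∧ pq.2.Prime)),
      Λ pq.1 * Λ pq.2 ≤ 2 * Real.log n * (ψ (n : ℝ) - θ (n : ℝ)) := by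
    set NP := (antidiagonal n).filter (fun pq => ¬ (pq.1.Prime ∧ pq.2.Prime)) with hNPdef
    have hsplit := (Finset.sum_filter_add_sum_filter_not NP (fun pq => pq.1.Prime)
      (fun pq => Λ pq.1 * Λ pq.2)).symm
    have h1 : ∑ pq ∈ NP.filter (fun pq => pq.1.Prime), Λ pq.1 * Λ pq.2 ≤
        ∑ pq ∈ (antidiagonal n).filter (fun pq => ¬ pq.2.Prime), Λ pq.1 * Λ pq.2 := by
      refine Finset.sum_le_sum_of_subset_of_nonneg (fun pq hpq => ?_) fun _ _ _ =>
        mul_nonneg ArithmeticFunction.vonMangoldt_nonneg ArithmeticFunction.vonMangoldt_nonneg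
      simp only [hNPdef, mem_filter, not_and] at hpq ⊢
      exact ⟨hpq.1.1, hpq.1.2 hpq.2⟩
    have h2 : ∑ pq ∈ NP.filter (fun pq => ¬ pq.1.Prime), Λ pq.1 * Λ pq.2 ≤
        ∑ pq ∈ (antidiagonal n).filter (fun pq => ¬ pq.1.Prime), Λ pq.1 * Λ pq.2 := by
      refine Finset.sum_le_sum_of_subset_of_nonneg (fun pq hpq => ?_) fun _ _ _ =>
        mul_nonneg ArithmeticFunction.vonMangoldt_nonneg ArithmeticFunction.vonMangoldt_nonneg
      simp only [hNPdef, mem_filter] at hpq ⊢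
      exact ⟨hpq.1.1, hpq.2⟩
    rw [hsplit]
    have := sum_fst_not_prime_le n
    have := sum_snd_not_prime_le n
    linarith
  have hcheb : ψ (n : ℝ) - θ (n : ℝ) ≤ 2 * Real.sqrt n * Real.log n :=
    Chebyshev.psi_sub_theta_le (by exact_mod_cast hn)
  have hG : goldbachLambdaCount n = ∑ pq ∈ ((antidiagonal n).filter fun pq => pq.1.Prime ∧ pq.2.Prime), Λ pq.1 * Λ pq.2 +
      ∑ pq ∈ (antidiagonal n).filter (fun pq => ¬ (pq.1.Prime ∧ pq.2.Prime)), Λ pq.1 * Λ pq.2 := by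
    rw [goldbachLambdaCount, Finset.sum_filter_add_sum_filter_not]
  rw [hG]
  have h4 : 2 * Real.log n * (ψ (n : ℝ) - θ (n : ℝ)) ≤ 4 * Real.sqrt n * Real.log n ^ 2 := by
    calc 2 * Real.log n * (ψ (n : ℝ) - θ (n : ℝ)) ≤ 2 * Real.log n * (2 * Real.sqrt n * Real.log n) :=
          mul_le_mul_of_nonneg_left hcheb (by positivity)
      _ = 4 * Real.sqrt n * Real.log n ^ 2 := by ring
  linarith

/-- The prime pairs with first entry `≤ y` are at most `⌊y⌋ + 1` in number (a pair on the
antidiagonal is determined by its first coordinate). [folklore] -/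
private theorem card_primePairs_fst_le (n : ℕ) (y : ℝ) :
    #(((antidiagonal n).filter fun pq => pq.1.Prime ∧ pq.2.Prime).filter fun pq => (pq.1 : ℝ) ≤ y) ≤ ⌊y⌋₊ + 1 := by
  calc #(((antidiagonal n).filter fun pq => pq.1.Prime ∧ pq.2.Prime).filter fun pq => (pq.1 : ℝ) ≤ y) ≤ #(range (⌊y⌋₊ + 1)) := by
        refine Finset.card_le_card_of_injOn Prod.fst (fun pq hpq => ?_) (fun p hp q hq hpq => ?_)
        · simp only [coe_filter, Set.mem_setOf_eq] at hpq
          simp only [coe_range, Set.mem_Iio, Nat.lt_succ_iff]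
          exact Nat.le_floor hpq.2
        · simp only [coe_filter, Set.mem_setOf_eq, mem_filter] at hp hq
          exact (Finset.HasAntidiagonal.antidiagonal_congr hp.1.1 hq.1.1).2 hpq
    _ = ⌊y⌋₊ + 1 := Finset.card_range _

/-- The prime pairs with second entry `≤ y` are at most `⌊y⌋ + 1` in number. [folklore] -/
private theorem card_primePairs_snd_le (n : ℕ) (y : ℝ) :
    #(((antidiagonal n).filter fun pq => pq.1.Prime ∧ pq.2.Prime).filter fun pq => (pq.2 : ℝ) ≤ y) ≤ ⌊y⌋₊ + 1 := by
  calc #(((antidiagonal n).filter fun pq => pq.1.Prime ∧ pq.2.Prime).filter fun pq => (pq.2 : ℝ) ≤ y) ≤ #(range (⌊y⌋₊ + 1)) := by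
        refine Finset.card_le_card_of_injOn Prod.snd (fun pq hpq => ?_) (fun p hp q hq hpq => ?_)
        · simp only [coe_filter, Set.mem_setOf_eq] at hpq
          simp only [coe_range, Set.mem_Iio, Nat.lt_succ_iff]
          exact Nat.le_floor hpq.2
        · simp only [coe_filter, Set.mem_setOf_eq, mem_filter] at hp hq
          exact (Finset.HasAntidiagonal.antidiagonal_congr' hp.1.1 hq.1.1).2 hpq
    _ = ⌊y⌋₊ + 1 := Finset.card_range _

/-- **Lower comparison** (unconditional): for every `n` and every real `y ≥ 1`,
`G(n) ≥ (R(n) − 2(⌊y⌋ + 1)) (log y)²` — drop the prime powers, keep the prime pairs with both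
entries `> y` (each contributes `≥ (log y)²`), of which there are at least `R(n) − 2(⌊y⌋ + 1)`.
[cite: GoldstonSuriajaya2021, §1 (1)–(2)] -/
theorem goldbachLambdaCount_ge (n : ℕ) {y : ℝ} (hy : 1 ≤ y) :
    ((SingularSeries.goldbachCount n : ℝ) - 2 * (⌊y⌋₊ + 1)) * Real.log y ^ 2 ≤
      goldbachLambdaCount n := by
  have hlogy : 0 ≤ Real.log y := Real.log_nonneg hy
  set P' := ((antidiagonal n).filter fun pq => pq.1.Prime ∧ pq.2.Prime).filter (fun pq => y < (pq.1 : ℝ) ∧ y < (pq.2 : ℝ)) with hP'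
  -- counting: `R(n) ≤ #P' + 2(⌊y⌋ + 1)`
  have hcount : (SingularSeries.goldbachCount n : ℝ) - 2 * (⌊y⌋₊ + 1) ≤ #P' := by
    have hsub : ((antidiagonal n).filter fun pq => pq.1.Prime ∧ pq.2.Prime) ⊆ P' ∪ (((antidiagonal n).filter fun pq => pq.1.Prime ∧ pq.2.Prime).filter fun pq => (pq.1 : ℝ) ≤ y) ∪
        (((antidiagonal n).filter fun pq => pq.1.Prime ∧ pq.2.Prime).filter fun pq => (pq.2 : ℝ) ≤ y) := by
      intro pq hpq
      simp only [hP', mem_union, mem_filter] at hpq ⊢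
      by_cases h1 : (pq.1 : ℝ) ≤ y
      · exact Or.inl (Or.inr ⟨hpq, h1⟩)
      by_cases h2 : (pq.2 : ℝ) ≤ y
      · exact Or.inr ⟨hpq, h2⟩
      · exact Or.inl (Or.inl ⟨hpq, lt_of_not_ge h1, lt_of_not_ge h2⟩)
    have hcard := (Finset.card_le_card hsub).trans
      ((Finset.card_union_le _ _).trans (Nat.add_le_add_right (Finset.card_union_le _ _) _))
    have h1 := card_primePairs_fst_le n y
    have h2 := card_primePairs_snd_le n y
    rw [← card_primePairs]
    have : (#((antidiagonal n).filter fun pq => pq.1.Prime ∧ pq.2.Prime) : ℝ) ≤ #P' + (⌊y⌋₊ + 1 : ℝ) + (⌊y⌋₊ + 1 : ℝ) := by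
      exact_mod_cast hcard.trans (by omega)
    linarith
  calc ((SingularSeries.goldbachCount n : ℝ) - 2 * (⌊y⌋₊ + 1)) * Real.log y ^ 2
      ≤ (#P' : ℝ) * Real.log y ^ 2 := mul_le_mul_of_nonneg_right hcount (by positivity)
    _ = ∑ pq ∈ P', Real.log y ^ 2 := by rw [Finset.sum_const, nsmul_eq_mul]
    _ ≤ ∑ pq ∈ P', Λ pq.1 * Λ pq.2 := by
        refine Finset.sum_le_sum fun pq hpq => ?_
        simp only [hP', mem_filter] at hpq
        obtain ⟨⟨-, hp, hq⟩, h1, h2⟩ := hpq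
        rw [ArithmeticFunction.vonMangoldt_apply_prime hp, ArithmeticFunction.vonMangoldt_apply_prime hq,
          sq]
        exact mul_le_mul (Real.log_le_log (by linarith) h1.le) (Real.log_le_log (by linarith) h2.le)
          hlogy ((hlogy.trans (Real.log_le_log (by linarith) h1.le)))
    _ ≤ ∑ pq ∈ ((antidiagonal n).filter fun pq => pq.1.Prime ∧ pq.2.Prime), Λ pq.1 * Λ pq.2 :=
        Finset.sum_le_sum_of_subset_of_nonneg (Finset.filter_subset _ _) fun _ _ _ =>
          mul_nonneg ArithmeticFunction.vonMangoldt_nonneg ArithmeticFunction.vonMangoldt_nonneg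
    _ ≤ goldbachLambdaCount n := by
        rw [goldbachLambdaCount]
        exact Finset.sum_le_sum_of_subset_of_nonneg (Finset.filter_subset _ _) fun _ _ _ =>
          mul_nonneg ArithmeticFunction.vonMangoldt_nonneg ArithmeticFunction.vonMangoldt_nonneg

/-! ### The two small-o inputs -/

/-- `(log x)² ≤ κ x^s` for all large real `x` (any `s, κ > 0`; Mathlib's
`isLittleO_log_rpow_rpow_atTop`). [folklore] -/
private theorem eventually_log_sq_le (s κ : ℝ) (hs : 0 < s) (hκ : 0 < κ) :
    ∀ᶠ x : ℝ in atTop, Real.log x ^ 2 ≤ κ * x ^ s := by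
  have h := (isLittleO_log_rpow_rpow_atTop 2 hs).def hκ
  filter_upwards [h, eventually_ge_atTop 1] with x hx hx1
  have hl : 0 ≤ Real.log x := Real.log_nonneg hx1
  rw [Real.norm_of_nonneg (Real.rpow_nonneg hl _), Real.norm_of_nonneg (Real.rpow_nonneg (by linarith) _),
    Real.rpow_two] at hx
  exact hx

/-- `4 √n (log n)² ≤ κ n` for all large `n` (any `κ > 0`). [folklore] -/
private theorem eventually_sqrt_mul_log_sq_le {κ : ℝ} (hκ : 0 < κ) :
    ∀ᶠ n : ℕ in atTop, 4 * Real.sqrt n * Real.log n ^ 2 ≤ κ * n := by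
  have h := tendsto_natCast_atTop_atTop.eventually
    (eventually_log_sq_le (1 / 2) (κ / 4) (by norm_num) (by positivity))
  filter_upwards [h] with n hn
  have hn0 : (0 : ℝ) ≤ n := Nat.cast_nonneg n
  rw [← Real.sqrt_eq_rpow] at hn
  calc 4 * Real.sqrt n * Real.log n ^ 2 ≤ 4 * Real.sqrt n * (κ / 4 * Real.sqrt n) :=
        mul_le_mul_of_nonneg_left hn (by positivity)
    _ = κ * (Real.sqrt n * Real.sqrt n) := by ring
    _ = κ * n := by rw [Real.mul_self_sqrt hn0]

/-- `2 (n^{1−η} + 1)(log n)² ≤ κ n` for all large `n` (any `κ > 0`, `0 < η ≤ 1`). [folklore] -/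
private theorem eventually_rpow_mul_log_sq_le {κ η : ℝ} (hκ : 0 < κ) (hη : 0 < η) (hη1 : η ≤ 1) :
    ∀ᶠ n : ℕ in atTop, 2 * ((n : ℝ) ^ (1 - η) + 1) * Real.log n ^ 2 ≤ κ * n := by
  have h := tendsto_natCast_atTop_atTop.eventually
    (eventually_log_sq_le η (κ / 4) hη (by positivity))
  filter_upwards [h, eventually_ge_atTop 1] with n hn hn1
  have hn1' : (1 : ℝ) ≤ n := by exact_mod_cast hn1
  have hn0 : (0 : ℝ) < n := by linarith
  have hpow1 : (1 : ℝ) ≤ (n : ℝ) ^ (1 - η) := Real.one_le_rpow hn1' (by linarith)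
  have hmul : (n : ℝ) ^ (1 - η) * (n : ℝ) ^ η = n := by
    rw [← Real.rpow_add hn0, sub_add_cancel, Real.rpow_one]
  calc 2 * ((n : ℝ) ^ (1 - η) + 1) * Real.log n ^ 2
      ≤ 2 * ((n : ℝ) ^ (1 - η) + (n : ℝ) ^ (1 - η)) * Real.log n ^ 2 := by
        gcongr
    _ = 4 * (n : ℝ) ^ (1 - η) * Real.log n ^ 2 := by ring
    _ ≤ 4 * (n : ℝ) ^ (1 - η) * (κ / 4 * (n : ℝ) ^ η) :=
        mul_le_mul_of_nonneg_left hn (by positivity)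
    _ = κ * ((n : ℝ) ^ (1 - η) * (n : ℝ) ^ η) := by ring
    _ = κ * n := by rw [hmul]

/-! ### Conjecture A in von Mangoldt form -/

/-- The core estimate, for `0 < ε ≤ 1`. [folklore] -/
private theorem eventually_bounds_of_le_one (h : HardyLittlewoodGoldbach) {ε : ℝ} (hε : 0 < ε)
    (hε1 : ε ≤ 1) :
    ∀ᶠ n : ℕ in atTop ⊓ 𝓟 {n : ℕ | Even n},
      (1 - ε) * (goldbachSingularSeries n * n) ≤ goldbachLambdaCount n ∧
        goldbachLambdaCount n ≤ (1 + ε) * (goldbachSingularSeries n * n) := by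
  set s₀ : ℝ := 2 * twinPrimeConst with hs₀
  have hs₀pos : 0 < s₀ := mul_pos two_pos twinPrimeConst_pos_holds
  -- Conjecture A as a two-sided bound with relative error `ε/4`
  have hR : ∀ᶠ n : ℕ in atTop ⊓ 𝓟 {n : ℕ | Even n},
      |(SingularSeries.goldbachCount n : ℝ) - goldbachSingularSeries n * n / Real.log n ^ 2| ≤
        ε / 4 * (goldbachSingularSeries n * n / Real.log n ^ 2) := by
    have := h.isLittleO.def (c := ε / 4) (by positivity)
    filter_upwards [this] with n hn
    have hM : 0 ≤ goldbachSingularSeries n * n / Real.log n ^ 2 := by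
      have : 0 ≤ goldbachSingularSeries n := by
        rcases Nat.even_or_odd n with he | ho
        · exact (goldbachSingularSeries_pos he).le
        · simp [goldbachSingularSeries, ho]
      positivity
    have hn' := hn
    simp only [Pi.sub_apply] at hn'
    rw [Real.norm_eq_abs, Real.norm_of_nonneg hM] at hn'
    exact hn'
  have hEven : ∀ᶠ n : ℕ in atTop ⊓ 𝓟 {n : ℕ | Even n}, Even n :=
    eventually_inf_principal.2 (Eventually.of_forall fun _ hn => hn)
  have hA := (eventually_sqrt_mul_log_sq_le (κ := ε / 2 * s₀) (by positivity)).filter_mono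
    (inf_le_left : atTop ⊓ 𝓟 {n : ℕ | Even n} ≤ atTop)
  have hB := (eventually_rpow_mul_log_sq_le (κ := ε / 4 * s₀) (η := ε / 4) (by positivity)
    (by positivity) (by linarith)).filter_mono (inf_le_left : atTop ⊓ 𝓟 {n : ℕ | Even n} ≤ atTop)
  have h2 := (eventually_ge_atTop 2).filter_mono (inf_le_left : atTop ⊓ 𝓟 {n : ℕ | Even n} ≤ atTop)
  filter_upwards [hR, hEven, hA, hB, h2] with n hRn hn hAn hBn hn2
  have hn1 : (1 : ℝ) < n := by exact_mod_cast hn2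
  have hn0 : (0 : ℝ) < n := by linarith
  have hlogpos : 0 < Real.log n := Real.log_pos hn1
  have hL : Real.log n ^ 2 ≠ 0 := by positivity
  have hS : s₀ ≤ goldbachSingularSeries n := two_mul_twinPrimeConst_le_goldbachSingularSeries hn
  have hSpos : 0 < goldbachSingularSeries n := hs₀pos.trans_le hS
  set J : ℝ := goldbachSingularSeries n * n with hJ
  have hJs : s₀ * n ≤ J := mul_le_mul_of_nonneg_right hS hn0.le
  have hJpos : 0 < J := mul_pos hSpos hn0
  set M : ℝ := J / Real.log n ^ 2 with hMdef
  have hMJ : M * Real.log n ^ 2 = J := div_mul_cancel₀ J hL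
  set R : ℝ := (SingularSeries.goldbachCount n : ℝ) with hRdef
  have hRup : R ≤ (1 + ε / 4) * M := by
    have := (abs_le.1 hRn).2; rw [hMdef]; linarith
  have hRlo : (1 - ε / 4) * M ≤ R := by
    have := (abs_le.1 hRn).1; rw [hMdef]; linarith
  constructor
  · -- lower bound with `y = n^{1 - ε/4}`
    set η : ℝ := ε / 4 with hη
    have hη1 : η ≤ 1 / 4 := by rw [hη]; linarith
    have hy1 : (1 : ℝ) ≤ (n : ℝ) ^ (1 - η) := Real.one_le_rpow hn1.le (by linarith)
    have hlow := goldbachLambdaCount_ge n hy1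
    have hlogy : Real.log ((n : ℝ) ^ (1 - η)) = (1 - η) * Real.log n := Real.log_rpow hn0 _
    rw [hlogy] at hlow
    have hfloor : (⌊(n : ℝ) ^ (1 - η)⌋₊ : ℝ) ≤ (n : ℝ) ^ (1 - η) := Nat.floor_le (by positivity)
    -- `(R − 2(⌊y⌋+1)) (1−η)² log² n ≥ ((1−η)M·... ) − error`
    have hstep : ((1 - η) * M - 2 * ((n : ℝ) ^ (1 - η) + 1)) * ((1 - η) * Real.log n) ^ 2 ≤
        (R - 2 * (⌊(n : ℝ) ^ (1 - η)⌋₊ + 1)) * ((1 - η) * Real.log n) ^ 2 := by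
      apply mul_le_mul_of_nonneg_right _ (by positivity)
      rw [hη] at hRlo ⊢; linarith
    have hcube : (1 - 3 * η) * J ≤ (1 - η) * M * ((1 - η) * Real.log n) ^ 2 := by
      have : (1 - η) * M * ((1 - η) * Real.log n) ^ 2 = (1 - η) ^ 3 * J := by
        rw [← hMJ]; ring
      rw [this]
      have hη0 : 0 ≤ η := by rw [hη]; linarith
      have h3 : 0 ≤ η ^ 2 * (3 - η) := mul_nonneg (sq_nonneg η) (by linarith)
      have hc : 1 - 3 * η ≤ (1 - η) ^ 3 := by ring_nf; ring_nf at h3; linarith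
      exact mul_le_mul_of_nonneg_right hc hJpos.le
    have herr : 2 * ((n : ℝ) ^ (1 - η) + 1) * ((1 - η) * Real.log n) ^ 2 ≤ η * J := by
      calc 2 * ((n : ℝ) ^ (1 - η) + 1) * ((1 - η) * Real.log n) ^ 2
          ≤ 2 * ((n : ℝ) ^ (1 - η) + 1) * Real.log n ^ 2 := by
            apply mul_le_mul_of_nonneg_left _ (by positivity)
            rw [mul_pow]
            have hη0 : 0 ≤ η := by rw [hη]; linarith
            have h1η : (1 - η) ^ 2 ≤ 1 := by nlinarith
            exact mul_le_of_le_one_left (sq_nonneg _) h1η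
        _ ≤ η * s₀ * n := by rw [hη]; exact hBn
        _ ≤ η * J := by rw [mul_assoc]; exact mul_le_mul_of_nonneg_left hJs (by rw [hη]; linarith)
    have : (1 - ε) * J ≤ (1 - 3 * η) * J - η * J := by rw [hη]; ring_nf; exact le_rfl
    calc (1 - ε) * J ≤ (1 - 3 * η) * J - η * J := this
      _ ≤ (1 - η) * M * ((1 - η) * Real.log n) ^ 2 -
          2 * ((n : ℝ) ^ (1 - η) + 1) * ((1 - η) * Real.log n) ^ 2 := by linarith
      _ = ((1 - η) * M - 2 * ((n : ℝ) ^ (1 - η) + 1)) * ((1 - η) * Real.log n) ^ 2 := by ring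
      _ ≤ (R - 2 * (⌊(n : ℝ) ^ (1 - η)⌋₊ + 1)) * ((1 - η) * Real.log n) ^ 2 := hstep
      _ ≤ goldbachLambdaCount n := hlow
  · -- upper bound
    have hup := goldbachLambdaCount_le (n := n) (by omega)
    calc goldbachLambdaCount n ≤ R * Real.log n ^ 2 + 4 * Real.sqrt n * Real.log n ^ 2 := hup
      _ ≤ (1 + ε / 4) * M * Real.log n ^ 2 + ε / 2 * s₀ * n := by
          gcongr
      _ ≤ (1 + ε / 4) * J + ε / 2 * J := by
          rw [mul_assoc, hMJ]
          have : ε / 2 * s₀ * n ≤ ε / 2 * J := by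
            rw [mul_assoc]; exact mul_le_mul_of_nonneg_left hJs (by positivity)
          linarith
      _ ≤ (1 + ε) * J := by nlinarith

/-- **Conjecture A in von Mangoldt form, two-sided bounds.** Under the Hardy–Littlewood Goldbach
asymptotic `R(N) ∼ 𝔖(N)N/(log N)²` (count form, along even `N`), for every `ε > 0`:
`(1 − ε)𝔖(n)n ≤ G(n) ≤ (1 + ε)𝔖(n)n` for all sufficiently large even `n`, where
`G(n) = ∑_{m + m' = n} Λ(m)Λ(m')` (`goldbachLambdaCount`). [cite: GoldstonSuriajaya2021, §1 (2)] -/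
theorem HardyLittlewoodGoldbach.eventually_goldbachLambdaCount_bounds (h : HardyLittlewoodGoldbach)
    {ε : ℝ} (hε : 0 < ε) :
    ∀ᶠ n : ℕ in atTop ⊓ 𝓟 {n : ℕ | Even n},
      (1 - ε) * (goldbachSingularSeries n * n) ≤ goldbachLambdaCount n ∧
        goldbachLambdaCount n ≤ (1 + ε) * (goldbachSingularSeries n * n) := by
  have hcore := eventually_bounds_of_le_one h (ε := min ε 1) (lt_min hε one_pos) (min_le_right _ _)
  filter_upwards [hcore] with n hn
  have hJ : 0 ≤ goldbachSingularSeries n * n := by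
    have : 0 ≤ goldbachSingularSeries n := by
      rcases Nat.even_or_odd n with he | ho
      · exact (goldbachSingularSeries_pos he).le
      · simp [goldbachSingularSeries, ho]
    positivity
  have hmin : min ε 1 ≤ ε := min_le_left _ _
  constructor
  · nlinarith [hn.1]
  · nlinarith [hn.2]

/-- **Conjecture A in von Mangoldt form** (Goldston–Suriajaya (2): "for `n` even,
`ψ₂(n) ∼ 𝔖(n)n`"): under `HardyLittlewoodGoldbach`, `G(n) ∼ J(n) = 𝔖(n)n` (`goldbachHLMain`)
as `n → ∞` through even integers. [cite: GoldstonSuriajaya2021, §1 (2)] -/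
theorem HardyLittlewoodGoldbach.isEquivalent_goldbachLambdaCount (h : HardyLittlewoodGoldbach) :
    (fun n : ℕ => goldbachLambdaCount n) ~[atTop ⊓ 𝓟 {n : ℕ | Even n}]
      fun n : ℕ => goldbachHLMain n := by
  refine Asymptotics.isLittleO_iff.2 fun c hc => ?_
  filter_upwards [h.eventually_goldbachLambdaCount_bounds hc] with n hn
  have hJ : 0 ≤ goldbachSingularSeries n * n := by
    have : 0 ≤ goldbachSingularSeries n := by
      rcases Nat.even_or_odd n with he | ho
      · exact (goldbachSingularSeries_pos he).le
      · simp [goldbachSingularSeries, ho]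
    positivity
  simp only [Pi.sub_apply, goldbachHLMain, Real.norm_eq_abs, abs_of_nonneg hJ]
  rw [abs_le]
  constructor <;> linarith [hn.1, hn.2]

/-- **Conjecture A implies the Weak Hardy–Littlewood Goldbach Conjecture for every `0 < δ < 1`**
(Goldston–Suriajaya (5): `δ𝔖(n)n ≤ ψ₂(n) ≤ (2 − δ)𝔖(n)n` for all large even `n`; their
`ψ₂(n)` is the tree's `goldbachLambdaCount n`). [cite: GoldstonSuriajaya2021, §1 (2), (5)] -/
theorem HardyLittlewoodGoldbach.weakHLGoldbachConj (h : HardyLittlewoodGoldbach) {δ : ℝ}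
    (_h0 : 0 < δ) (h1 : δ < 1) : WeakHLGoldbachConj δ := by
  have hε : 0 < 1 - δ := by linarith
  have hev := h.eventually_goldbachLambdaCount_bounds hε
  rw [eventually_inf_principal, eventually_atTop] at hev
  obtain ⟨n₀, hn₀⟩ := hev
  refine ⟨n₀, fun n hn he => ?_⟩
  have := hn₀ n hn he
  constructor
  · have h := this.1; ring_nf at h ⊢; linarith
  · have h := this.2; ring_nf at h ⊢; linarith

end Literature.NumberTheory.Sieve
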